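import Literature.AnabelianGeometry.SemiGraphs.FreeGroupsAndActionsProofs2
import Literature.AnabelianGeometry.SemiGraphs.SubdivisionPaths
import Literature.AnabelianGeometry.SemiGraphs.SubdivisionLemmas
import Mathlib.Combinatorics.SimpleGraph.Metric
import HarnessLib

/-!
# Fixed vertex systems at bounded distance in an inverse system of trees ([SemiAnbd] Thm. 3.7 (iii), p. 41)

Mochizuki, *Semi-graphs of anabelioids*, Publ. RIMS **42** (2006), Thm. 3.7 (iii) and its proof, p. 41,
with the author's *Comments* (2020) (6): the compact subgroup `H` acts on the inverse system of trees
`𝒢_{∞,j}`; compatible systems of `H`-fixed vertices are read off, and "if `H` fixes two vertices … these two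
vertices are joined … by a single [closed] edge" — else a fixed SUBJOINT appears, which total estrangement
forbids. [cite: MochizukiSemiAnbd2006, Thm. 3.7(iii) p.41]

PROOF-ONLY tool file (cell abc-iut, layer L3; GAP row G-t6g3-2 «Thm 3.7 (iii)/Cor 3.9 beyond finite 𝒢»,
sub-row E2-bounded of abc-iut-L3-t10's SHAPES memo `SHAPES-Ggt6g32.md` §(e), ruling α27; seat
abc-iut-w5-d160; no definition; nothing specific to anabelioids).  For a subgroup `C` of a group `P`
acting on a system of TREES `T j` with transition morphisms `f : T j ⟶ T i` (`i ≤ j`), and two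
COMPATIBLE systems `x`, `x'` of `C`-fixed vertices:

* `SemiGraph.dist_inl_vertexMap_le` — a morphism of semi-graphs does not increase the distance of
  vertices in the barycentric subdivision; hence the level distances `ℓ_j = dist (x j) (x' j)` are
  non-decreasing in `j` (`dist_le_dist_of_compatible`);
* `SemiGraph.exists_fixedBranchPairSystem_of_dist_eq` — if `ℓ_j` is CONSTANT `> 4` above a level `j₀`
  (two or more edges apart), the level geodesics map isomorphically onto each other and are pointwise
  `C`-fixed (Lemma 1.8 (ii)(b)), so their first interior vertices with the two abutting geodesic branches
  form a COMPATIBLE system of `C`-fixed branch-pairs (a compatible fixed subjoint system) above `j₀`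
  (edge form: `SemiGraph.exists_fixedEdgePairSystem_of_dist_eq`) — the antecedents of the estrangement
  kill `SemiGraph.eq_bot_of_fixedSubjointSystem` / `eq_bot_of_fixedEdgePairSystem` (abc-iut-L3-t10,
  `TreeFixedSubjointSystemKill.lean`) VERBATIM;
* `SemiGraph.adjacent_of_bounded_dist_of_noFixedBranchPairSystem` — consequently, if `(ℓ_j)` is
  BOUNDED and `C ≠ 1` fixes no compatible system of branch-pairs of the trees above any level (the
  tree-level form of the estrangement input, shaped exactly as the hypothesis `hnobp` of abc-iut-L3-t11's
  `SemiGraph.hstar_of_noFixedBranchPairSystem` with the trees in place of the finite levels), then at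
  EVERY level where `x j ≠ x' j` the two vertices are joined by a `C`-fixed edge — the second clause `hadj`
  of the input (FIX∞) of the memo, in the bounded case.

TEST CASE (abc-iut-w4-d075's `𝒢⋆`, STATUS 2026-08-26T00:33:43Z): there the only compatible fixed vertex
system of a compact `H = ⟨x⟩ ≠ 1` is the system of centres `(ṽ_j)`, so the hypotheses "two compatible
fixed systems, eventually distinct, at bounded distance" are never met and nothing false is asserted; the
unbounded case (escape to an end / along an infinite valence) is the open sub-row G-t6g3-2b and is NOT
touched here.
-/

namespace Literature.AnabelianGeometry.SemiGraphs

namespace SemiGraph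

open CategoryTheory

universe v u

/-! ### Paths between vertex-points: positions `0 … 4` and `5, 6` -/

section Shape

variable {G : SemiGraph.{u}}

/-- **Positions along a path between two distinct vertices** (the tree's `path_between_vertices_shape`
with the node positions exposed): a path `w₁ ⇝ w₂`, `w₁ ≠ w₂`, of the subdivision reads
`w₁ – c₁ – e₁ – c₁' – v₁ – ⋯` with `c₁ ≠ c₁'` the two branches of `e₁` at `w₁`, `v₁`; its length is `≥ 4`.
[cite: MochizukiSemiAnbd2006, Lem. 1.8(ii)(c) p.20] -/
theorem path_inl_prefix {w₁ w₂ : G.Vertex} (hne : w₁ ≠ w₂)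
    (p : G.subdivision.Walk (Sum.inl w₁) (Sum.inl w₂)) (hp : p.IsPath) :
    4 ≤ p.length ∧ ∃ (c₁ c₁' : G.Branch) (e₁ : G.Edge) (v₁ : G.Vertex), c₁ ≠ c₁' ∧
      G.edgeOf c₁ = e₁ ∧ G.edgeOf c₁' = e₁ ∧ G.abuts c₁ = some w₁ ∧ G.abuts c₁' = some v₁ ∧
      p.getVert 1 = Sum.inr (Sum.inr c₁) ∧ p.getVert 2 = Sum.inr (Sum.inl e₁) ∧
      p.getVert 3 = Sum.inr (Sum.inr c₁') ∧ p.getVert 4 = Sum.inl v₁ := by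
  set n := p.length with hn
  have hx0 : p.getVert 0 = Sum.inl w₁ := p.getVert_zero
  have h0n : 0 < n := lt_length_of_getVert_ne p (Nat.zero_le _) (by rw [hx0]; simpa using hne)
  obtain ⟨c₁, hc₁v, hx1⟩ := step_vertex p h0n hx0
  have h1n : 1 < n := lt_length_of_getVert_ne p h0n (by rw [hx1]; simp)
  have hx2 : p.getVert 2 = Sum.inr (Sum.inl (G.edgeOf c₁)) := by
    rcases step_branch p h1n hx1 with h | ⟨v, hv, h⟩
    · exact h
    · exfalso
      have hvw : v = w₁ := by rw [hc₁v] at hv; simpa using hv.symm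
      exact getVert_add_two_ne p hp (i := 0) (by omega) (by rw [h, hx0, hvw])
  have h2n : 2 < n := lt_length_of_getVert_ne p h1n (by rw [hx2]; simp)
  obtain ⟨c₁', hc₁'e, hx3⟩ := step_edge p h2n hx2
  have hcc : c₁' ≠ c₁ := by
    intro h
    exact getVert_add_two_ne p hp (i := 1) (by omega) (by rw [hx3, hx1, h])
  have h3n : 3 < n := lt_length_of_getVert_ne p h2n (by rw [hx3]; simp)
  obtain ⟨v₁, hc₁'v, hx4⟩ : ∃ v₁ : G.Vertex, G.abuts c₁' = some v₁ ∧ p.getVert 4 = Sum.inl v₁ := by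
    rcases step_branch p h3n hx3 with h | h
    · exfalso
      exact getVert_add_two_ne p hp (i := 2) (by omega) (by rw [h, hx2, hc₁'e])
    · exact h
  exact ⟨by omega, c₁, c₁', G.edgeOf c₁, v₁, fun h => hcc h.symm, rfl, hc₁'e, hc₁v, hc₁'v, hx1, hx2,
    hx3, hx4⟩

/-- **Positions `5`, `6`**: if moreover the path is longer than `4`, then `v₁` (node `4`) is an interior
vertex: node `5` is a branch `c₂ ≠ c₁'` at `v₁` and node `6` its edge `e₂ ≠ e₁`.
[cite: MochizukiSemiAnbd2006, Lem. 1.8(ii)(c) p.20] -/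
theorem path_inl_interior {w₁ w₂ : G.Vertex} (hne : w₁ ≠ w₂)
    (p : G.subdivision.Walk (Sum.inl w₁) (Sum.inl w₂)) (hp : p.IsPath) (h4 : 4 < p.length) :
    ∃ (c₁' c₂ : G.Branch) (v₁ : G.Vertex), c₁' ≠ c₂ ∧ G.abuts c₁' = some v₁ ∧ G.abuts c₂ = some v₁ ∧
      G.edgeOf c₁' ≠ G.edgeOf c₂ ∧
      p.getVert 3 = Sum.inr (Sum.inr c₁') ∧ p.getVert 4 = Sum.inl v₁ ∧
      p.getVert 5 = Sum.inr (Sum.inr c₂) := by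
  obtain ⟨-, c₁, c₁', e₁, v₁, -, -, hc₁'e, -, hc₁'v, -, hx2, hx3, hx4⟩ := path_inl_prefix hne p hp
  obtain ⟨c₂, hc₂v, hx5⟩ := step_vertex p h4 hx4
  have hcc : c₁' ≠ c₂ := by
    intro h
    exact getVert_add_two_ne p hp (i := 3) (by omega) (by rw [hx5, hx3, h])
  have h5n : 5 < p.length := lt_length_of_getVert_ne p (by omega) (by rw [hx5]; simp)
  have hx6 : p.getVert 6 = Sum.inr (Sum.inl (G.edgeOf c₂)) := by
    rcases step_branch p h5n hx5 with h | ⟨v, hv, h⟩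
    · exact h
    · exfalso
      have hvv : v = v₁ := by rw [hc₂v] at hv; simpa using hv.symm
      exact getVert_add_two_ne p hp (i := 4) (by omega) (by rw [h, hx4, hvv])
  have hee : G.edgeOf c₁' ≠ G.edgeOf c₂ := by
    intro h
    have h26 : p.getVert 2 = p.getVert 6 := by rw [hx2, hx6, ← h, hc₁'e]
    have := hp.getVert_injOn (by simp; omega) (by simp; omega) h26
    omega
  exact ⟨c₁', c₂, v₁, hcc, hc₁'v, hc₂v, hee, hx3, hx4, hx5⟩

/-- A path of length exactly `4` between distinct vertices is `w₁ – c – e – c' – w₂`: the two vertices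
are joined by the edge at node `2`. [cite: MochizukiSemiAnbd2006, Lem. 1.8(ii)(c) p.20] -/
theorem joins_of_path_length_four {w₁ w₂ : G.Vertex} (hne : w₁ ≠ w₂)
    (p : G.subdivision.Walk (Sum.inl w₁) (Sum.inl w₂)) (hp : p.IsPath) (h4 : p.length = 4) :
    ∃ (e : G.Edge) (c c' : G.Branch), c ≠ c' ∧ G.edgeOf c = e ∧ G.edgeOf c' = e ∧
      G.abuts c = some w₁ ∧ G.abuts c' = some w₂ ∧ p.getVert 2 = Sum.inr (Sum.inl e) := by
  obtain ⟨-, c₁, c₁', e₁, v₁, hcc, hc₁e, hc₁'e, hc₁v, hc₁'v, -, hx2, -, hx4⟩ := path_inl_prefix hne p hp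
  have hv : v₁ = w₂ := by
    have h := p.getVert_length
    rw [h4, hx4] at h
    simpa using h
  exact ⟨e₁, c₁, c₁', hcc, hc₁e, hc₁'e, hc₁v, hv ▸ hc₁'v, hx2⟩

end Shape

/-! ### Distances of vertex-points do not increase along morphisms -/

section Dist

variable {G G' : SemiGraph.{u}}

/-- **A morphism of semi-graphs does not increase distances** of vertex-points in the barycentric
subdivision (it induces a homomorphism of the subdivisions, `subdivision_adj_map`), for `G` connected.
[cite: MochizukiSemiAnbd2006, §1 p.11] -/
theorem dist_inl_vertexMap_le (hG : G.IsConnected) (φ : G ⟶ G') (u u' : G.Vertex) :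
    G'.subdivision.dist (Sum.inl (φ.vertexMap u)) (Sum.inl (φ.vertexMap u')) ≤
      G.subdivision.dist (Sum.inl u) (Sum.inl u') := by
  obtain ⟨q, hq⟩ := hG.connected.exists_walk_length_eq_dist (Sum.inl u) (Sum.inl u')
  let Φ : G.subdivision →g G'.subdivision :=
    ⟨Sum.map φ.vertexMap (Sum.map φ.edgeMap φ.branchMap), fun h => subdivision_adj_map φ h⟩
  have h1 : G'.subdivision.dist (Sum.inl (φ.vertexMap u)) (Sum.inl (φ.vertexMap u')) ≤
      (q.map Φ).length := SimpleGraph.dist_le (q.map Φ)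
  rw [SimpleGraph.Walk.length_map, hq] at h1
  exact h1

end Dist

/-! ### Systems of trees: compatible fixed vertex systems at bounded distance -/

section System

variable {P : Type u} [Group P] {J : Type v} [Preorder J]

/-- **Level distances are non-decreasing**: for compatible vertex systems `x`, `x'` and `i ≤ j`,
`dist (x i) (x' i) ≤ dist (x j) (x' j)`. [cite: MochizukiSemiAnbd2006, Thm. 3.7(iii) p.41] -/
theorem dist_le_dist_of_compatible (T : J → SemiGraph.{u}) (hT : ∀ j, (T j).IsTree)
    (f : ∀ ⦃i j : J⦄, i ≤ j → (T j ⟶ T i)) (x x' : ∀ j, (T j).Vertex)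
    (hx : ∀ ⦃i j : J⦄ (h : i ≤ j), (f h).vertexMap (x j) = x i)
    (hx' : ∀ ⦃i j : J⦄ (h : i ≤ j), (f h).vertexMap (x' j) = x' i) ⦃i j : J⦄ (h : i ≤ j) :
    (T i).subdivision.dist (Sum.inl (x i)) (Sum.inl (x' i)) ≤
      (T j).subdivision.dist (Sum.inl (x j)) (Sum.inl (x' j)) := by
  have h1 := dist_inl_vertexMap_le ⟨(hT j).isTree.connected⟩ (f h) (x j) (x' j)
  rw [hx h, hx' h] at h1
  exact h1

/-- The construction behind `exists_fixedBranchPairSystem_of_dist_eq` /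
`exists_fixedEdgePairSystem_of_dist_eq`, with all four pieces of data recorded (the two geodesic branches
at the first interior vertex lie on DISTINCT edges). [cite: MochizukiSemiAnbd2006, Thm. 3.7(iii) p.41] -/
theorem exists_fixedBranchPairSystem_of_dist_eq_aux (C : Subgroup P) (T : J → SemiGraph.{u})
    (hT : ∀ j, (T j).IsTree) (ρ : ∀ j, P →* Aut (T j)) (f : ∀ ⦃i j : J⦄, i ≤ j → (T j ⟶ T i))
    (x x' : ∀ j, (T j).Vertex)
    (hx : ∀ ⦃i j : J⦄ (h : i ≤ j), (f h).vertexMap (x j) = x i)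
    (hx' : ∀ ⦃i j : J⦄ (h : i ≤ j), (f h).vertexMap (x' j) = x' i)
    (hfx : ∀ (j : J) (γ : C), (ρ j γ).hom.vertexMap (x j) = x j)
    (hfx' : ∀ (j : J) (γ : C), (ρ j γ).hom.vertexMap (x' j) = x' j)
    (j₀ : J) {d : ℕ} (hd : ∀ j : J, j₀ ≤ j → (T j).subdivision.dist (Sum.inl (x j)) (Sum.inl (x' j)) = d)
    (h4 : 4 < d) :
    ∃ (w : ∀ i : {i : J // j₀ ≤ i}, (T i.1).Vertex) (β β' : ∀ i : {i : J // j₀ ≤ i}, (T i.1).Branch),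
      (∀ i, β i ≠ β' i ∧ (T i.1).abuts (β i) = some (w i) ∧ (T i.1).abuts (β' i) = some (w i)) ∧
      (∀ i, (T i.1).edgeOf (β i) ≠ (T i.1).edgeOf (β' i)) ∧
      (∀ ⦃i i' : {i : J // j₀ ≤ i}⦄ (h : i.1 ≤ i'.1), (f h).vertexMap (w i') = w i ∧
        (f h).branchMap (β i') = β i ∧ (f h).branchMap (β' i') = β' i) ∧
      (∀ (i : {i : J // j₀ ≤ i}) (γ : C), (ρ i.1 γ).hom.vertexMap (w i) = w i ∧
        (ρ i.1 γ).hom.branchMap (β i) = β i ∧ (ρ i.1 γ).hom.branchMap (β' i) = β' i) := by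
  classical
  -- the two systems are distinct at every level `≥ j₀`
  have hne : ∀ i : {i : J // j₀ ≤ i}, x i.1 ≠ x' i.1 := by
    intro i h
    have h0 := hd i.1 i.2
    rw [h, SimpleGraph.dist_self] at h0
    omega
  -- the level geodesics
  have hgeo : ∀ i : {i : J // j₀ ≤ i},
      ∃ p : (T i.1).subdivision.Walk (Sum.inl (x i.1)) (Sum.inl (x' i.1)), p.IsPath ∧ p.length = d := by
    intro i
    obtain ⟨p, hp⟩ :=
      (hT i.1).isTree.connected.exists_walk_length_eq_dist (Sum.inl (x i.1)) (Sum.inl (x' i.1))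
    exact ⟨p, p.isPath_of_length_eq_dist hp, hp.trans (hd i.1 i.2)⟩
  choose geo hgeo_path hgeo_len using hgeo
  -- their first interior vertex with the two abutting geodesic branches (nodes `3`, `4`, `5`)
  have hint : ∀ i : {i : J // j₀ ≤ i}, ∃ (c₁' c₂ : (T i.1).Branch) (v₁ : (T i.1).Vertex), c₁' ≠ c₂ ∧
      (T i.1).abuts c₁' = some v₁ ∧ (T i.1).abuts c₂ = some v₁ ∧ (T i.1).edgeOf c₁' ≠ (T i.1).edgeOf c₂ ∧
      (geo i).getVert 3 = Sum.inr (Sum.inr c₁') ∧ (geo i).getVert 4 = Sum.inl v₁ ∧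
      (geo i).getVert 5 = Sum.inr (Sum.inr c₂) :=
    fun i => path_inl_interior (hne i) (geo i) (hgeo_path i) (by rw [hgeo_len i]; exact h4)
  choose β β' w hββ' hβw hβ'w hee h3 h4' h5 using hint
  refine ⟨w, β, β', fun i => ⟨hββ' i, hβw i, hβ'w i⟩, hee, ?_, ?_⟩
  · -- compatibility: the image of the geodesic at level `i'` IS the geodesic at level `i ≤ i'`
    intro i i' h
    let Φ : (T i'.1).subdivision →g (T i.1).subdivision :=
      ⟨Sum.map (f h).vertexMap (Sum.map (f h).edgeMap (f h).branchMap),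
        fun hab => subdivision_adj_map (f h) hab⟩
    have hΦv : ∀ u : (T i'.1).Vertex, Φ (Sum.inl u) = Sum.inl ((f h).vertexMap u) := fun _ => rfl
    have hΦb : ∀ b : (T i'.1).Branch, Φ (Sum.inr (Sum.inr b)) = Sum.inr (Sum.inr ((f h).branchMap b)) :=
      fun _ => rfl
    have e₁ : Φ (Sum.inl (x i'.1)) = Sum.inl (x i.1) := by rw [hΦv, hx h]
    have e₂ : Φ (Sum.inl (x' i'.1)) = Sum.inl (x' i.1) := by rw [hΦv, hx' h]
    let W : (T i.1).subdivision.Walk (Sum.inl (x i.1)) (Sum.inl (x' i.1)) := ((geo i').map Φ).copy e₁ e₂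
    have hWlen : W.length = (T i.1).subdivision.dist (Sum.inl (x i.1)) (Sum.inl (x' i.1)) := by
      simp only [W, SimpleGraph.Walk.length_copy, SimpleGraph.Walk.length_map, hgeo_len, hd i.1 i.2]
    have hW : W.IsPath := W.isPath_of_length_eq_dist hWlen
    have hWeq : W = geo i :=
      congrArg Subtype.val ((hT i.1).isTree.isAcyclic.path_unique ⟨W, hW⟩ ⟨geo i, hgeo_path i⟩)
    have hk : ∀ k, Φ ((geo i').getVert k) = (geo i).getVert k := fun k => by
      have hWk := congrArg (fun q : (T i.1).subdivision.Walk _ _ => q.getVert k) hWeq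
      simpa only [W, SimpleGraph.Walk.getVert_copy, SimpleGraph.Walk.getVert_map] using hWk
    have k4 := hk 4
    rw [h4' i', hΦv, h4' i] at k4
    have k3 := hk 3
    rw [h3 i', hΦb, h3 i] at k3
    have k5 := hk 5
    rw [h5 i', hΦb, h5 i] at k5
    exact ⟨Sum.inl_injective k4, Sum.inr_injective (Sum.inr_injective k3),
      Sum.inr_injective (Sum.inr_injective k5)⟩
  · -- fixedness: `C` fixes the end-points, hence the whole geodesic (Lemma 1.8 (ii)(b))
    intro i γ
    have hA : (T i.1).subdivision.IsAcyclic := (hT i.1).isTree.isAcyclic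
    have hfix : ∀ z ∈ (geo i).support, nodeMap (ρ i.1 γ) z = z :=
      nodeMap_eq_self_of_isPath hA (ρ i.1 γ) (x := Sum.inl (x i.1)) (y := Sum.inl (x' i.1))
        (by simp only [nodeMap, Sum.map_inl, hfx]) (by simp only [nodeMap, Sum.map_inl, hfx'])
        (geo i) (hgeo_path i)
    have f4 := hfix _ ((geo i).getVert_mem_support 4)
    have f3 := hfix _ ((geo i).getVert_mem_support 3)
    have f5 := hfix _ ((geo i).getVert_mem_support 5)
    rw [h4' i] at f4
    rw [h3 i] at f3
    rw [h5 i] at f5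
    exact ⟨Sum.inl_injective f4, Sum.inr_injective (Sum.inr_injective f3),
      Sum.inr_injective (Sum.inr_injective f5)⟩

/-- **Constant distance `> 4` above a level yields a compatible fixed branch-pair system.**  If two
compatible systems `x`, `x'` of `C`-fixed vertices have the SAME distance `d > 4` at all levels `j ≥ j₀`
(two or more edges apart, stably), then the level geodesics correspond under the transition maps and are
pointwise `C`-fixed ([SemiAnbd] Lem. 1.8 (ii)(b)), and their first interior vertices `w j` together with
the two geodesic branches `β j ≠ β' j` abutting to `w j` form a compatible system of `C`-fixed
branch-pairs above `j₀` (a compatible fixed subjoint system — what total estrangement forbids).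
[cite: MochizukiSemiAnbd2006, Thm. 3.7(iii) p.41] -/
theorem exists_fixedBranchPairSystem_of_dist_eq (C : Subgroup P) (T : J → SemiGraph.{u})
    (hT : ∀ j, (T j).IsTree) (ρ : ∀ j, P →* Aut (T j)) (f : ∀ ⦃i j : J⦄, i ≤ j → (T j ⟶ T i))
    (x x' : ∀ j, (T j).Vertex)
    (hx : ∀ ⦃i j : J⦄ (h : i ≤ j), (f h).vertexMap (x j) = x i)
    (hx' : ∀ ⦃i j : J⦄ (h : i ≤ j), (f h).vertexMap (x' j) = x' i)
    (hfx : ∀ (j : J) (γ : C), (ρ j γ).hom.vertexMap (x j) = x j)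
    (hfx' : ∀ (j : J) (γ : C), (ρ j γ).hom.vertexMap (x' j) = x' j)
    (j₀ : J) {d : ℕ} (hd : ∀ j : J, j₀ ≤ j → (T j).subdivision.dist (Sum.inl (x j)) (Sum.inl (x' j)) = d)
    (h4 : 4 < d) :
    ∃ (w : ∀ i : {i : J // j₀ ≤ i}, (T i.1).Vertex) (β β' : ∀ i : {i : J // j₀ ≤ i}, (T i.1).Branch),
      (∀ i, β i ≠ β' i ∧ (T i.1).abuts (β i) = some (w i) ∧ (T i.1).abuts (β' i) = some (w i)) ∧
      (∀ ⦃i i' : {i : J // j₀ ≤ i}⦄ (h : i.1 ≤ i'.1), (f h).vertexMap (w i') = w i ∧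
        (f h).branchMap (β i') = β i ∧ (f h).branchMap (β' i') = β' i) ∧
      (∀ (i : {i : J // j₀ ≤ i}) (γ : C), (ρ i.1 γ).hom.vertexMap (w i) = w i ∧
        (ρ i.1 γ).hom.branchMap (β i) = β i ∧ (ρ i.1 γ).hom.branchMap (β' i) = β' i) := by
  obtain ⟨w, β, β', h1, -, h2, h3⟩ :=
    exists_fixedBranchPairSystem_of_dist_eq_aux C T hT ρ f x x' hx hx' hfx hfx' j₀ hd h4
  exact ⟨w, β, β', h1, h2, h3⟩

/-- **Edge form**: under the same hypotheses (distance constant `> 4` above `j₀`), the first interior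
vertices `m i` of the level geodesics together with the two DISTINCT geodesic edges `ε i ≠ ε' i` abutting
to `m i` form a compatible system of `C`-fixed edge-pairs above `j₀` — the shape consumed by the edge form
of the estrangement kill (`SemiGraph.eq_bot_of_fixedEdgePairSystem`, abc-iut-L3-t10).
[cite: MochizukiSemiAnbd2006, Thm. 3.7(iii) p.41] -/
theorem exists_fixedEdgePairSystem_of_dist_eq (C : Subgroup P) (T : J → SemiGraph.{u})
    (hT : ∀ j, (T j).IsTree) (ρ : ∀ j, P →* Aut (T j)) (f : ∀ ⦃i j : J⦄, i ≤ j → (T j ⟶ T i))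
    (x x' : ∀ j, (T j).Vertex)
    (hx : ∀ ⦃i j : J⦄ (h : i ≤ j), (f h).vertexMap (x j) = x i)
    (hx' : ∀ ⦃i j : J⦄ (h : i ≤ j), (f h).vertexMap (x' j) = x' i)
    (hfx : ∀ (j : J) (γ : C), (ρ j γ).hom.vertexMap (x j) = x j)
    (hfx' : ∀ (j : J) (γ : C), (ρ j γ).hom.vertexMap (x' j) = x' j)
    (j₀ : J) {d : ℕ} (hd : ∀ j : J, j₀ ≤ j → (T j).subdivision.dist (Sum.inl (x j)) (Sum.inl (x' j)) = d)
    (h4 : 4 < d) :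
    ∃ (m : ∀ i : {i : J // j₀ ≤ i}, (T i.1).Vertex) (ε ε' : ∀ i : {i : J // j₀ ≤ i}, (T i.1).Edge),
      (∀ i, ε i ≠ ε' i ∧ (T i.1).EdgeAbuts (ε i) (m i) ∧ (T i.1).EdgeAbuts (ε' i) (m i)) ∧
      (∀ ⦃i i' : {i : J // j₀ ≤ i}⦄ (h : i.1 ≤ i'.1), (f h).vertexMap (m i') = m i ∧
        (f h).edgeMap (ε i') = ε i ∧ (f h).edgeMap (ε' i') = ε' i) ∧
      (∀ (i : {i : J // j₀ ≤ i}) (γ : C), (ρ i.1 γ).hom.vertexMap (m i) = m i ∧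
        (ρ i.1 γ).hom.edgeMap (ε i) = ε i ∧ (ρ i.1 γ).hom.edgeMap (ε' i) = ε' i) := by
  obtain ⟨w, β, β', h1, hee, h2, h3⟩ :=
    exists_fixedBranchPairSystem_of_dist_eq_aux C T hT ρ f x x' hx hx' hfx hfx' j₀ hd h4
  refine ⟨w, fun i => (T i.1).edgeOf (β i), fun i => (T i.1).edgeOf (β' i),
    fun i => ⟨hee i, ⟨β i, rfl, (h1 i).2.1⟩, ⟨β' i, rfl, (h1 i).2.2⟩⟩, fun i i' h => ?_, fun i γ => ?_⟩
  · obtain ⟨hw, hβ, hβ'⟩ := h2 h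
    exact ⟨hw, by rw [← (f h).edgeOf_branchMap, hβ], by rw [← (f h).edgeOf_branchMap, hβ']⟩
  · obtain ⟨hw, hβ, hβ'⟩ := h3 i γ
    exact ⟨hw, by rw [← (ρ i.1 γ).hom.edgeOf_branchMap, hβ],
      by rw [← (ρ i.1 γ).hom.edgeOf_branchMap, hβ']⟩

/-- **Bounded distance + no compatible fixed branch-pair system ⇒ adjacency at every level.**  Let
`C ≠ 1` fix two compatible vertex systems `x`, `x'` of the directed system of trees whose level distances
are BOUNDED, and assume the tree-level estrangement input: `C` fixes no compatible system of branch-pairs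
above any level (else `C = 1`; the shape of the hypothesis `hnobp` of
`SemiGraph.hstar_of_noFixedBranchPairSystem`, with the trees in place of the finite levels).  Then at every
level where `x j ≠ x' j` the two vertices are joined by an edge fixed by `C` — the second clause of the
fixed-systems input (FIX∞) of [SemiAnbd] Thm. 3.7 (iii) beyond finite semi-graphs, in the bounded case.
[cite: MochizukiSemiAnbd2006, Thm. 3.7(iii) p.41] -/
theorem adjacent_of_bounded_dist_of_noFixedBranchPairSystem (C : Subgroup P) (T : J → SemiGraph.{u})
    (hT : ∀ j, (T j).IsTree) (ρ : ∀ j, P →* Aut (T j)) (f : ∀ ⦃i j : J⦄, i ≤ j → (T j ⟶ T i))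
    (hnobp : ∀ (j₀ : J) (w : ∀ i : {i : J // j₀ ≤ i}, (T i.1).Vertex)
      (β β' : ∀ i : {i : J // j₀ ≤ i}, (T i.1).Branch),
      (∀ i, β i ≠ β' i ∧ (T i.1).abuts (β i) = some (w i) ∧ (T i.1).abuts (β' i) = some (w i)) →
      (∀ ⦃i i' : {i : J // j₀ ≤ i}⦄ (h : i.1 ≤ i'.1), (f h).vertexMap (w i') = w i ∧
        (f h).branchMap (β i') = β i ∧ (f h).branchMap (β' i') = β' i) →
      (∀ (i : {i : J // j₀ ≤ i}) (γ : C), (ρ i.1 γ).hom.vertexMap (w i) = w i ∧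
        (ρ i.1 γ).hom.branchMap (β i) = β i ∧ (ρ i.1 γ).hom.branchMap (β' i) = β' i) → C = ⊥)
    (hC : C ≠ ⊥) (x x' : ∀ j, (T j).Vertex)
    (hx : ∀ ⦃i j : J⦄ (h : i ≤ j), (f h).vertexMap (x j) = x i)
    (hx' : ∀ ⦃i j : J⦄ (h : i ≤ j), (f h).vertexMap (x' j) = x' i)
    (hfx : ∀ (j : J) (γ : C), (ρ j γ).hom.vertexMap (x j) = x j)
    (hfx' : ∀ (j : J) (γ : C), (ρ j γ).hom.vertexMap (x' j) = x' j)
    (hbdd : ∃ N : ℕ, ∀ j, (T j).subdivision.dist (Sum.inl (x j)) (Sum.inl (x' j)) ≤ N)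
    (j : J) (hne : x j ≠ x' j) :
    ∃ (e : (T j).Edge) (b b' : (T j).Branch), b ≠ b' ∧ (T j).edgeOf b = e ∧ (T j).edgeOf b' = e ∧
      (T j).abuts b = some (x j) ∧ (T j).abuts b' = some (x' j) ∧
      ∀ γ : C, (ρ j γ).hom.edgeMap e = e := by
  classical
  obtain ⟨N, hN⟩ := hbdd
  -- the (bounded, monotone) level distances attain their maximum `M` at some level `j₀`
  set ℓ : J → ℕ := fun j => (T j).subdivision.dist (Sum.inl (x j)) (Sum.inl (x' j)) with hℓ
  have hmono : ∀ ⦃i i' : J⦄, i ≤ i' → ℓ i ≤ ℓ i' := fun i i' h =>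
    dist_le_dist_of_compatible T hT f x x' hx hx' h
  have hbdd' : BddAbove (Set.range ℓ) := ⟨N, by rintro _ ⟨i, rfl⟩; exact hN i⟩
  have hmem : sSup (Set.range ℓ) ∈ Set.range ℓ := Nat.sSup_mem ⟨ℓ j, j, rfl⟩ hbdd'
  obtain ⟨j₀, hj₀⟩ := hmem
  have hmax : ∀ i, ℓ i ≤ ℓ j₀ := fun i => hj₀ ▸ le_csSup hbdd' ⟨i, rfl⟩
  by_cases hM : 4 < ℓ j₀
  · -- stably `≥ 2` edges apart above `j₀`: a compatible fixed branch-pair system, excluded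
    exfalso
    have hconst : ∀ i : J, j₀ ≤ i → ℓ i = ℓ j₀ := fun i hi => le_antisymm (hmax i) (hmono hi)
    obtain ⟨w, β, β', h1, h2, h3⟩ :=
      exists_fixedBranchPairSystem_of_dist_eq C T hT ρ f x x' hx hx' hfx hfx' j₀ hconst hM
    exact hC (hnobp j₀ w β β' h1 h2 h3)
  · -- `ℓ j ≤ 4`, and `≥ 4` since `x j ≠ x' j`: the geodesic is one edge, fixed by `C`
    have hA : (T j).subdivision.IsAcyclic := (hT j).isTree.isAcyclic
    obtain ⟨p, hp⟩ := (hT j).isTree.connected.exists_walk_length_eq_dist (Sum.inl (x j)) (Sum.inl (x' j))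
    have hpath : p.IsPath := p.isPath_of_length_eq_dist hp
    have hlen : p.length = 4 := by
      have h1 := (path_inl_prefix hne p hpath).1
      have h2 : ℓ j ≤ 4 := (hmax j).trans (not_lt.mp hM)
      have h3 : p.length = ℓ j := hp
      omega
    obtain ⟨e, b, b', hbb', hbe, hb'e, hbx, hb'x, hx2⟩ := joins_of_path_length_four hne p hpath hlen
    refine ⟨e, b, b', hbb', hbe, hb'e, hbx, hb'x, fun γ => ?_⟩
    have hfix := nodeMap_eq_self_of_isPath hA (ρ j γ) (x := Sum.inl (x j)) (y := Sum.inl (x' j))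
      (by simp only [nodeMap, Sum.map_inl, hfx]) (by simp only [nodeMap, Sum.map_inl, hfx']) p hpath
      _ (p.getVert_mem_support 2)
    rw [hx2] at hfix
    exact Sum.inl_injective (Sum.inr_injective hfix)

end System

end SemiGraph

end Literature.AnabelianGeometry.SemiGraphs
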